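import Summits.ValiantsHypothesis.ValiantsHypothesis.Theorems.SymmetroidPencilBasics
import Literature.NumberTheory.GaloisRepresentations.ResidualRepOfTraceCongruence

/-!
# `MatrixDescartes` census — DOOR A at `(3,4)`: NO NINEFOLD COALESCENCE — a real symmetric `(3,3)` pencil `S₀ + t·S₁ + t⁴·1` never has a
# positive determinant root of multiplicity `9` (the Descartes-extremal multiplicity); the discriminant of the characteristic polynomial of a
# real symmetric `3 × 3` matrix is non-negative

HONEST FRAMING.  Object-search cell `pub-symmetroid`, engine seat `val-sym-eng-2` (g3); helper row beside the registered strata line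
`Cruxes/DoorA34/Lines/strata.lean` on stmt-ValiantsHypothesis-19980 (`DoorA34 = PosRootLawAt 3 4 18`: OPEN, typed, never asserted here),
stubs `stub_nullTopCeiling` / `stub_nullNullCeiling` OPEN on the generic sheet.  Companion of `…CensusDoorA34AllPlusSeven` /
`…SingularBottomAllPlusSix`: in the hierarchical class of that sheet the flag route needs a `(3,3)` source with NINE positive det-roots ALL of
semidefinite type (the FLAG LAW `Census.flagLaw_no_five_one`); the located all-(+) capacity is `7`, and this seat's exact contact-order table
(DOOR-A34-ENG2G3-REPORT §3) shows the obstruction already at the TOTALLY COALESCED configuration: nine PSD-singular times merging at one point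
`t₀` give a ninefold determinant root, and with a definite (normalised: identity) top letter on `(0,1,4)` the ten-monomial support of
`det(S₀ + tS₁ + t⁴·1) = t¹² + tr(S₀+tS₁)·t⁸ + e₂(S₀+tS₁)·t⁴ + det(S₀+tS₁)` forces the cofactor — `(t − t₀)⁹ ∣ det ⇒ det = (t−t₀)⁹(t³ + 9t₀t² + 45t₀²t + 77t₀³)`
— hence forces `tr`, `e₂`, `det` of the symmetric matrix `S₀ + m·S₁` for EVERY real `m`; at `m = (19/10)·t₀` the forced characteristic polynomial has
NEGATIVE discriminant, which no real symmetric matrix allows.  This file proves the case `t₀ = 1` and reduces the general `t₀ > 0` to it by the scaling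
`t ↦ t₀t`, `S₀ ↦ t₀⁻⁴S₀`, `S₁ ↦ t₀⁻³S₁` (`eval_det_pencil_scale`, **`not_ninefold_root`**, appended 2026-08-28):

* `cubic_discr_eq_sq` — the discriminant of `(X−a)(X−b)(X−c)` is `((a−b)(a−c)(b−c))²`;
* **`discr_charpoly_nonneg_of_isSymm`** — for a real symmetric `3 × 3` matrix `A`, `18·e₁e₂e₃ − 4e₁³e₃ + e₁²e₂² − 4e₂³ − 27e₃² ≥ 0` with
  `e₁ = tr A`, `e₂ = Σ principal 2 × 2 minors`, `e₃ = det A` (spectral theorem `Matrix.IsHermitian.charpoly_eq` + `Matrix.charpoly_fin_three`);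
* `det_pencil_explicit` — the ten coefficients of `det(S₀ + X·S₁ + X⁴·1)` in terms of `tr`, `e₂`, `det`, `tr(adj · ·)` of the letters;
* `remainder_identity` — division of that `12`-nomial form by `(X − 1)⁹` with explicit quotient and remainder (a `ring` identity);
* **`not_ninefold_root_one`** — for real symmetric `S₀, S₁`: `¬ (X − 1)⁹ ∣ det(S₀ + X·S₁ + X⁴·1)` (pencil written in the census currency
  `∑ l, X^{d l} • (S l).map C` with `d = (0,1,4)`, `S = (S₀, S₁, 1)`).

Nothing here bounds `ζ_sym(3,4)` (registers `18 ≤ ζ_sym(3,4) ≤ 19` unchanged); no law about nine DISTINCT roots is claimed (nine distinct roots with a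
definite letter exist in the census); nothing on `MatrixDescartes` (stmt-ValiantsHypothesis-18050) or `VP ≠ VNP` — VP≠VNP not moved.
[folklore] spectral theorem for real symmetric matrices, Vieta, polynomial division; certificates by `ring` / `norm_num` / `simp`.
-/

-- `Summit.ValiantsHypothesis.ValiantsHypothesis.…` repeats a component by the D-0017 layout
-- (single-conjunct summit), which the `dupNamespace` linter flags; the name is mandated.
set_option linter.dupNamespace false

namespace Summit.ValiantsHypothesis.ValiantsHypothesis.Theorems.LacunarySymmetroidMatrixDescartes.Census.NoNinefold

open Summit.ValiantsHypothesis.ValiantsHypothesis.Theorems.SymmetroidDescartes (eval_det_pencil)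
open scoped BigOperators Matrix
open Polynomial Finset

/-! ## The discriminant of the characteristic polynomial of a real symmetric `3 × 3` matrix -/

/-- Vieta form of the cubic discriminant: for the monic cubic with roots `a, b, c` (coefficients `−(a+b+c)`, `ab+ac+bc`, `−abc`) the discriminant
`18pqr − 4p³r + p²q² − 4q³ − 27r²` equals `((a−b)(a−c)(b−c))²`. [folklore] -/
theorem cubic_discr_eq_sq (a b c : ℝ) :
    18 * (-(a + b + c)) * (a * b + a * c + b * c) * (-(a * b * c)) - 4 * (-(a + b + c)) ^ 3 * (-(a * b * c))
      + (-(a + b + c)) ^ 2 * (a * b + a * c + b * c) ^ 2 - 4 * (a * b + a * c + b * c) ^ 3 - 27 * (-(a * b * c)) ^ 2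
      = ((a - b) * (a - c) * (b - c)) ^ 2 := by
  ring

/-- The product `(X − a)(X − b)(X − c)` in coefficient form. [folklore] -/
theorem prod_X_sub_C_three (a b c : ℝ) :
    (X - C a) * (X - C b) * (X - C c) = X ^ 3 - C (a + b + c) * X ^ 2 + C (a * b + a * c + b * c) * X - C (a * b * c) := by
  simp only [map_add, map_mul]
  ring

/-- Coefficient comparison for monic cubics written as `X³ − C p · X² + C q · X − C r`. [folklore] -/
theorem cubic_coeffs_eq {p q r p' q' r' : ℝ}
    (h : (X : ℝ[X]) ^ 3 - C p * X ^ 2 + C q * X - C r = X ^ 3 - C p' * X ^ 2 + C q' * X - C r') :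
    p = p' ∧ q = q' ∧ r = r' := by
  have h2 := congrArg (fun f : ℝ[X] => f.coeff 2) h
  have h1 := congrArg (fun f : ℝ[X] => f.coeff 1) h
  have h0 := congrArg (fun f : ℝ[X] => f.coeff 0) h
  simp only [coeff_sub, coeff_add, coeff_X_pow, coeff_C_mul, coeff_X, coeff_C] at h0 h1 h2
  norm_num at h0 h1 h2
  exact ⟨by linarith, by linarith, by linarith⟩

/-- **The discriminant of the characteristic polynomial of a real SYMMETRIC `3 × 3` matrix is non-negative** (all three eigenvalues are real):
with `e₁ = tr A`, `e₂ =` the sum of the principal `2 × 2` minors, `e₃ = det A`, the cubic `X³ − e₁X² + e₂X − e₃` has discriminant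
`18(−e₁)e₂(−e₃) − 4(−e₁)³(−e₃) + e₁²e₂² − 4e₂³ − 27e₃² ≥ 0`. [folklore] -/
theorem discr_charpoly_nonneg_of_isSymm (A : Matrix (Fin 3) (Fin 3) ℝ) (hA : A.IsSymm) :
    0 ≤ 18 * (-A.trace) * (A 0 0 * A 1 1 - A 0 1 * A 1 0 + (A 0 0 * A 2 2 - A 0 2 * A 2 0) + (A 1 1 * A 2 2 - A 1 2 * A 2 1)) * (-A.det)
        - 4 * (-A.trace) ^ 3 * (-A.det)
        + (-A.trace) ^ 2 * (A 0 0 * A 1 1 - A 0 1 * A 1 0 + (A 0 0 * A 2 2 - A 0 2 * A 2 0) + (A 1 1 * A 2 2 - A 1 2 * A 2 1)) ^ 2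
        - 4 * (A 0 0 * A 1 1 - A 0 1 * A 1 0 + (A 0 0 * A 2 2 - A 0 2 * A 2 0) + (A 1 1 * A 2 2 - A 1 2 * A 2 1)) ^ 3
        - 27 * (-A.det) ^ 2 := by
  have hH : A.IsHermitian := by
    unfold Matrix.IsHermitian
    rw [Matrix.conjTranspose_eq_transpose_of_trivial]
    exact hA
  have h1 := Matrix.charpoly_fin_three A
  have h2 := hH.charpoly_eq
  rw [Fin.prod_univ_three] at h2
  simp only [RCLike.ofReal_real_eq_id, id_eq] at h2
  rw [prod_X_sub_C_three] at h2
  rw [h1] at h2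
  obtain ⟨htr, he2, hdet⟩ := cubic_coeffs_eq h2
  rw [htr, he2, hdet, cubic_discr_eq_sq]
  positivity

/-! ## The pencil `S₀ + X·S₁ + X⁴·1` on `(0,1,4)`: explicit coefficients and division by `(X − 1)⁹` -/

/-- `det(A + μ·1) = μ³ + e₁(A)μ² + e₂(A)μ + det A` for `3 × 3` matrices. [folklore] -/
theorem det_add_smul_one_fin_three (A : Matrix (Fin 3) (Fin 3) ℝ) (μ : ℝ) :
    (A + μ • (1 : Matrix (Fin 3) (Fin 3) ℝ)).det
      = μ ^ 3 + A.trace * μ ^ 2 + (A 0 0 * A 1 1 - A 0 1 * A 1 0 + (A 0 0 * A 2 2 - A 0 2 * A 2 0) + (A 1 1 * A 2 2 - A 1 2 * A 2 1)) * μ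
        + A.det := by
  simp only [Matrix.det_fin_three, Matrix.trace_fin_three, Matrix.add_apply, Matrix.smul_apply, Matrix.one_apply, smul_eq_mul]
  simp
  ring

/-- `det(S₀ + m·S₁) = det S₀ + m·tr(adj S₀·S₁) + m²·tr(adj S₁·S₀) + m³·det S₁` for `3 × 3` matrices. [folklore] -/
theorem det_add_smul_fin_three (S₀ S₁ : Matrix (Fin 3) (Fin 3) ℝ) (m : ℝ) :
    (S₀ + m • S₁).det = S₀.det + (S₀.adjugate * S₁).trace * m + (S₁.adjugate * S₀).trace * m ^ 2 + S₁.det * m ^ 3 := by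
  simp only [Matrix.det_fin_three, Matrix.adjugate_fin_three, Matrix.trace_fin_three, Matrix.mul_apply, Fin.sum_univ_three,
    Matrix.add_apply, Matrix.smul_apply, smul_eq_mul]
  simp
  ring

/-- The principal-minor sum `e₂(S₀ + m·S₁)` as a quadratic in `m`. [folklore] -/
theorem e2_add_smul_fin_three (S₀ S₁ : Matrix (Fin 3) (Fin 3) ℝ) (m : ℝ) :
    ((S₀ + m • S₁) 0 0 * (S₀ + m • S₁) 1 1 - (S₀ + m • S₁) 0 1 * (S₀ + m • S₁) 1 0
        + ((S₀ + m • S₁) 0 0 * (S₀ + m • S₁) 2 2 - (S₀ + m • S₁) 0 2 * (S₀ + m • S₁) 2 0)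
        + ((S₀ + m • S₁) 1 1 * (S₀ + m • S₁) 2 2 - (S₀ + m • S₁) 1 2 * (S₀ + m • S₁) 2 1))
      = (S₀ 0 0 * S₀ 1 1 - S₀ 0 1 * S₀ 1 0 + (S₀ 0 0 * S₀ 2 2 - S₀ 0 2 * S₀ 2 0) + (S₀ 1 1 * S₀ 2 2 - S₀ 1 2 * S₀ 2 1))
        + (S₀ 0 0 * S₁ 1 1 + S₁ 0 0 * S₀ 1 1 - S₀ 0 1 * S₁ 1 0 - S₁ 0 1 * S₀ 1 0
            + (S₀ 0 0 * S₁ 2 2 + S₁ 0 0 * S₀ 2 2 - S₀ 0 2 * S₁ 2 0 - S₁ 0 2 * S₀ 2 0)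
            + (S₀ 1 1 * S₁ 2 2 + S₁ 1 1 * S₀ 2 2 - S₀ 1 2 * S₁ 2 1 - S₁ 1 2 * S₀ 2 1)) * m
        + (S₁ 0 0 * S₁ 1 1 - S₁ 0 1 * S₁ 1 0 + (S₁ 0 0 * S₁ 2 2 - S₁ 0 2 * S₁ 2 0) + (S₁ 1 1 * S₁ 2 2 - S₁ 1 2 * S₁ 2 1)) * m ^ 2 := by
  simp only [Matrix.add_apply, Matrix.smul_apply, smul_eq_mul]
  ring

/-- Evaluation of the census pencil `∑ l, X^{d l} • (S l).map C` with `d = (0,1,4)`, `S = (S₀, S₁, 1)` at a real point: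
`det(S₀ + t·S₁ + t⁴·1) = t¹² + e₁·t⁸ + e₂·t⁴ + e₃` with `eᵢ` the invariants of `S₀ + t·S₁`. [folklore] -/
theorem eval_det_pencil_eq (S₀ S₁ : Matrix (Fin 3) (Fin 3) ℝ) (t : ℝ) :
    ((∑ l, (X : ℝ[X]) ^ (![0, 1, 4] : Fin 3 → ℕ) l • ((![S₀, S₁, 1] : Fin 3 → Matrix (Fin 3) (Fin 3) ℝ) l).map C).det).eval t
      = (t ^ 4) ^ 3 + (S₀ + t • S₁).trace * (t ^ 4) ^ 2
        + ((S₀ + t • S₁) 0 0 * (S₀ + t • S₁) 1 1 - (S₀ + t • S₁) 0 1 * (S₀ + t • S₁) 1 0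
            + ((S₀ + t • S₁) 0 0 * (S₀ + t • S₁) 2 2 - (S₀ + t • S₁) 0 2 * (S₀ + t • S₁) 2 0)
            + ((S₀ + t • S₁) 1 1 * (S₀ + t • S₁) 2 2 - (S₀ + t • S₁) 1 2 * (S₀ + t • S₁) 2 1)) * t ^ 4
        + (S₀ + t • S₁).det := by
  rw [eval_det_pencil, ← det_add_smul_one_fin_three]
  congr 1
  ext i j
  simp [Fin.sum_univ_three, Matrix.add_apply, Matrix.smul_apply]

set_option maxHeartbeats 1600000 in
/-- **NO NINEFOLD ROOT AT `t = 1`.**  For real SYMMETRIC `3 × 3` letters `S₀, S₁`, the determinant of the pencil `S₀ + X·S₁ + X⁴·1` (support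
`(0,1,4)`, identity top letter) is NOT divisible by `(X − 1)⁹`: the nine PSD-singular times of a hypothetical all-(+) nine-row cannot coalesce. [folklore] -/
theorem not_ninefold_root_one (S₀ S₁ : Matrix (Fin 3) (Fin 3) ℝ) (h₀ : S₀.IsSymm) (h₁ : S₁.IsSymm) :
    ¬ ((X - C (1 : ℝ)) ^ 9 ∣
        (∑ l, (X : ℝ[X]) ^ (![0, 1, 4] : Fin 3 → ℕ) l • ((![S₀, S₁, 1] : Fin 3 → Matrix (Fin 3) (Fin 3) ℝ) l).map C).det) := by
  intro hdvd
  -- names for the nine coefficient invariants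
  set τ₀ : ℝ := S₀.trace with hτ₀
  set τ₁ : ℝ := S₁.trace with hτ₁
  set σ₀ : ℝ := S₀ 0 0 * S₀ 1 1 - S₀ 0 1 * S₀ 1 0 + (S₀ 0 0 * S₀ 2 2 - S₀ 0 2 * S₀ 2 0) + (S₀ 1 1 * S₀ 2 2 - S₀ 1 2 * S₀ 2 1) with hσ₀
  set σ₁ : ℝ := S₀ 0 0 * S₁ 1 1 + S₁ 0 0 * S₀ 1 1 - S₀ 0 1 * S₁ 1 0 - S₁ 0 1 * S₀ 1 0
            + (S₀ 0 0 * S₁ 2 2 + S₁ 0 0 * S₀ 2 2 - S₀ 0 2 * S₁ 2 0 - S₁ 0 2 * S₀ 2 0)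
            + (S₀ 1 1 * S₁ 2 2 + S₁ 1 1 * S₀ 2 2 - S₀ 1 2 * S₁ 2 1 - S₁ 1 2 * S₀ 2 1) with hσ₁
  set σ₂ : ℝ := S₁ 0 0 * S₁ 1 1 - S₁ 0 1 * S₁ 1 0 + (S₁ 0 0 * S₁ 2 2 - S₁ 0 2 * S₁ 2 0) + (S₁ 1 1 * S₁ 2 2 - S₁ 1 2 * S₁ 2 1) with hσ₂
  set δ₀ : ℝ := S₀.det with hδ₀
  set δ₁ : ℝ := (S₀.adjugate * S₁).trace with hδ₁
  set δ₂ : ℝ := (S₁.adjugate * S₀).trace with hδ₂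
  set δ₃ : ℝ := S₁.det with hδ₃
  set P : ℝ[X] := (∑ l, (X : ℝ[X]) ^ (![0, 1, 4] : Fin 3 → ℕ) l •
      ((![S₀, S₁, 1] : Fin 3 → Matrix (Fin 3) (Fin 3) ℝ) l).map C).det with hP
  -- the explicit ten-coefficient form of P
  have hPexp : P = X ^ 12 + C τ₁ * X ^ 9 + C τ₀ * X ^ 8 + C σ₂ * X ^ 6 + C σ₁ * X ^ 5 + C σ₀ * X ^ 4
      + C δ₃ * X ^ 3 + C δ₂ * X ^ 2 + C δ₁ * X ^ 1 + C δ₀ * X ^ 0 := by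
    apply Polynomial.funext
    intro t
    rw [hP, eval_det_pencil_eq, e2_add_smul_fin_three, det_add_smul_fin_three, Matrix.trace_add, Matrix.trace_smul, smul_eq_mul]
    simp only [eval_add, eval_mul, eval_C, eval_pow, eval_X]
    ring
  -- division by (X - 1)^9: explicit quotient and remainder
  set R : ℝ[X] := C (δ₀ + τ₁ + 165) * X ^ 0 + C (δ₁ - 9 * τ₁ - 1440) * X ^ 1 + C (δ₂ + 36 * τ₁ + 5544) * X ^ 2
      + C (δ₃ - 84 * τ₁ - 12320) * X ^ 3 + C (σ₀ + 126 * τ₁ + 17325) * X ^ 4 + C (σ₁ - 126 * τ₁ - 15840) * X ^ 5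
      + C (σ₂ + 84 * τ₁ + 9240) * X ^ 6 + C (-36 * τ₁ - 3168) * X ^ 7 + C (τ₀ + 9 * τ₁ + 495) * X ^ 8 with hR
  have hg : ((X - C (1 : ℝ)) ^ 9).Monic := (monic_X_sub_C 1).pow 9
  have hident : R + (X - C (1 : ℝ)) ^ 9 * (X ^ 3 + 9 * X ^ 2 + 45 * X + C (τ₁ + 165)) = P := by
    rw [hPexp, hR]
    simp only [map_add, map_sub, map_mul, map_neg, map_ofNat, map_one]
    ring
  have hRdeg : R.degree < ((X - C (1 : ℝ)) ^ 9).degree := by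
    have h9 : ((X - C (1 : ℝ)) ^ 9).degree = 9 := by
      rw [degree_pow, degree_X_sub_C]; rfl
    rw [h9]
    have : R.degree ≤ 8 := by
      rw [hR]
      compute_degree!
    exact lt_of_le_of_lt this (by norm_num)
  have hmod : P %ₘ ((X - C (1 : ℝ)) ^ 9) = R := (div_modByMonic_unique _ R hg ⟨hident, hRdeg⟩).2
  have hR0 : R = 0 := by
    rw [← hmod]
    exact (modByMonic_eq_zero_iff_dvd hg).mpr (hP ▸ hdvd)
  -- read off the forced coefficients
  have hc : ∀ k : ℕ, R.coeff k = 0 := fun k => by rw [hR0, coeff_zero]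
  have e7 := hc 7; have e8 := hc 8; have e4 := hc 4; have e5 := hc 5; have e6 := hc 6
  have e0 := hc 0; have e1 := hc 1; have e2 := hc 2; have e3 := hc 3
  simp only [hR, coeff_add, coeff_C_mul_X_pow] at e0 e1 e2 e3 e4 e5 e6 e7 e8
  norm_num at e0 e1 e2 e3 e4 e5 e6 e7 e8
  -- the symmetric matrix S₀ + (19/10)·S₁ would have a characteristic polynomial of negative discriminant
  set A : Matrix (Fin 3) (Fin 3) ℝ := S₀ + (19 / 10 : ℝ) • S₁ with hA
  have hAsymm : A.IsSymm := by
    rw [hA]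
    exact h₀.add (h₁.smul _)
  have hdisc := discr_charpoly_nonneg_of_isSymm A hAsymm
  have htrA : A.trace = τ₀ + τ₁ * (19 / 10) := by
    rw [hA, Matrix.trace_add, Matrix.trace_smul, smul_eq_mul]; ring
  have he2A : A 0 0 * A 1 1 - A 0 1 * A 1 0 + (A 0 0 * A 2 2 - A 0 2 * A 2 0) + (A 1 1 * A 2 2 - A 1 2 * A 2 1)
      = σ₀ + σ₁ * (19 / 10) + σ₂ * (19 / 10) ^ 2 := by
    rw [hA]; exact e2_add_smul_fin_three S₀ S₁ (19 / 10)
  have hdetA : A.det = δ₀ + δ₁ * (19 / 10) + δ₂ * (19 / 10) ^ 2 + δ₃ * (19 / 10) ^ 3 := by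
    rw [hA]; exact det_add_smul_fin_three S₀ S₁ (19 / 10)
  rw [htrA, he2A, hdetA] at hdisc
  have hτ₁v : τ₁ = -88 := by linarith only [e7]
  have hτ₀v : τ₀ = 297 := by linarith only [e8, hτ₁v]
  have hσ₀v : σ₀ = -6237 := by linarith only [e4, hτ₁v]
  have hσ₁v : σ₁ = 4752 := by linarith only [e5, hτ₁v]
  have hσ₂v : σ₂ = -1848 := by linarith only [e6, hτ₁v]
  have hδ₀v : δ₀ = -77 := by linarith only [e0, hτ₁v]
  have hδ₁v : δ₁ = 648 := by linarith only [e1, hτ₁v]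
  have hδ₂v : δ₂ = -2376 := by linarith only [e2, hτ₁v]
  have hδ₃v : δ₃ = 4928 := by linarith only [e3, hτ₁v]
  rw [hτ₁v, hτ₀v, hσ₀v, hσ₁v, hσ₂v, hδ₀v, hδ₁v, hδ₂v, hδ₃v] at hdisc
  norm_num at hdisc


/-! ## Every positive coalescence point: the scaling `t ↦ t₀·t` -/

/-- The census pencil at a real point is the real matrix `S₀ + t·S₁ + t⁴·1`. [folklore] -/
theorem sum_pencil_eq (S₀ S₁ : Matrix (Fin 3) (Fin 3) ℝ) (t : ℝ) :
    (∑ l, t ^ (![0, 1, 4] : Fin 3 → ℕ) l • (![S₀, S₁, 1] : Fin 3 → Matrix (Fin 3) (Fin 3) ℝ) l) = S₀ + t • S₁ + t ^ 4 • (1 : Matrix (Fin 3) (Fin 3) ℝ) := by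
  ext i j
  simp [Fin.sum_univ_three, Matrix.add_apply, Matrix.smul_apply]

/-- **Scaling law**: `det(S₀ + (t₀y)·S₁ + (t₀y)⁴·1) = t₀¹²·det(t₀⁻⁴S₀ + y·t₀⁻³S₁ + y⁴·1)` for `t₀ ≠ 0`. [folklore] -/
theorem eval_det_pencil_scale (S₀ S₁ : Matrix (Fin 3) (Fin 3) ℝ) {t₀ : ℝ} (ht : t₀ ≠ 0) (y : ℝ) :
    ((∑ l, (X : ℝ[X]) ^ (![0, 1, 4] : Fin 3 → ℕ) l • ((![S₀, S₁, 1] : Fin 3 → Matrix (Fin 3) (Fin 3) ℝ) l).map C).det).eval (t₀ * y) = t₀ ^ 12 * ((∑ l, (X : ℝ[X]) ^ (![0, 1, 4] : Fin 3 → ℕ) l • ((![((t₀⁻¹ ^ 4) • S₀), ((t₀⁻¹ ^ 3) • S₁), 1] : Fin 3 → Matrix (Fin 3) (Fin 3) ℝ) l).map C).det).eval y := by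
  rw [eval_det_pencil, eval_det_pencil, sum_pencil_eq, sum_pencil_eq]
  have hM : S₀ + (t₀ * y) • S₁ + (t₀ * y) ^ 4 • (1 : Matrix (Fin 3) (Fin 3) ℝ)
      = (t₀ ^ 4) • ((t₀⁻¹ ^ 4) • S₀ + y • ((t₀⁻¹ ^ 3) • S₁) + y ^ 4 • (1 : Matrix (Fin 3) (Fin 3) ℝ)) := by
    ext i j
    simp only [Matrix.add_apply, Matrix.smul_apply, smul_eq_mul]
    field_simp
  rw [hM, Matrix.det_smul, Fintype.card_fin]
  ring

/-- **NO NINEFOLD ROOT AT ANY `t₀ > 0`.**  For real SYMMETRIC `3 × 3` letters `S₀, S₁` and every `t₀ > 0`, `(X − t₀)⁹` does not divide the determinant of the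
pencil `S₀ + X·S₁ + X⁴·1`: the determinant of a real symmetric three-letter `(3,3)` pencil with identity top letter on `(0,1,4)` has NO positive root of the
Descartes-extremal multiplicity `9` (reduction to `t₀ = 1` by the scaling law). [folklore] -/
theorem not_ninefold_root (S₀ S₁ : Matrix (Fin 3) (Fin 3) ℝ) (h₀ : S₀.IsSymm) (h₁ : S₁.IsSymm) {t₀ : ℝ} (ht : 0 < t₀) :
    ¬ ((X - C t₀) ^ 9 ∣ (∑ l, (X : ℝ[X]) ^ (![0, 1, 4] : Fin 3 → ℕ) l • ((![S₀, S₁, 1] : Fin 3 → Matrix (Fin 3) (Fin 3) ℝ) l).map C).det) := by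
  rintro ⟨u, hu⟩
  have ht0 : t₀ ≠ 0 := ht.ne'
  apply not_ninefold_root_one ((t₀⁻¹ ^ 4) • S₀) ((t₀⁻¹ ^ 3) • S₁) (h₀.smul _) (h₁.smul _)
  refine ⟨C ((t₀⁻¹) ^ 3) * u.comp (C t₀ * X), ?_⟩
  apply Polynomial.funext
  intro y
  have h1 := eval_det_pencil_scale S₀ S₁ ht0 y
  have h2 := congrArg (fun p : ℝ[X] => p.eval (t₀ * y)) hu
  simp only [eval_mul, eval_pow, eval_sub, eval_X, eval_C] at h2
  rw [h1] at h2
  simp only [eval_mul, eval_pow, eval_sub, eval_X, eval_C, eval_comp]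
  have h3 : ((∑ l, (X : ℝ[X]) ^ (![0, 1, 4] : Fin 3 → ℕ) l • ((![((t₀⁻¹ ^ 4) • S₀), ((t₀⁻¹ ^ 3) • S₁), 1] : Fin 3 → Matrix (Fin 3) (Fin 3) ℝ) l).map C).det).eval y = t₀⁻¹ ^ 12 * ((t₀ * y - t₀) ^ 9 * u.eval (t₀ * y)) := by
    rw [← h2]; field_simp
  rw [h3]
  field_simp

end Summit.ValiantsHypothesis.ValiantsHypothesis.Theorems.LacunarySymmetroidMatrixDescartes.Census.NoNinefold
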